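import Mathlib
import HarnessLib
import Literature.Analysis.FluidPDE.ClassicalLocalEnergyCutoff
import Literature.Analysis.FluidPDE.KatoLocalLerayPressure
import Literature.Analysis.FluidPDE.HelmholtzAnnihilator
import Literature.Analysis.FunctionSpaces.Mollification
import Literature.Analysis.FluidPDE.MildSolutionProofs
import Literature.Analysis.FluidPDE.SereginSverakAxisWeightedCubic
import Literature.Analysis.FluidPDE.TypeIAncientMildClassical
import Summits.NavierStokesRegularity.NavierStokesRegularity.Theorems.PoloidalWindowDoorPoloidalWindowRigidityClassSpaceTimeRates
import Summits.NavierStokesRegularity.NavierStokesRegularity.Theorems.PoloidalWindowDoorPoloidalWindowRigidityClassRate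
import Summits.NavierStokesRegularity.NavierStokesRegularity.Theorems.PoloidalWindowDoorPoloidalWindowRigidityWindow
import Summits.NavierStokesRegularity.NavierStokesRegularity.Theorems.PoloidalWindowDoorPoloidalWindowRigidityEllipticSliceThinStrain

/-!
# Route `PoloidalWindowDoor`, crux `PoloidalWindowRigidity` (stmt-19708), line `sparse_energy` (cstrat g11) —
# stub S1 `stub_scaledEnergy`, first brick (I): the SLICE FLUX of the local energy identity against a translated cut-off is
# MEAN-FREE, and its oscillation bound; calculus of the far-field time weights

Seat ns-poloidal-K2-p2 g9 (successor of the interim LEAD-of-record on 19708; file `--supports`).  Tools for the sibling file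
`…SparseEnergyFarField` (the far-from-the-apex half of S1):

* `cutoffT_*` — the translated cut-off `ψ = cutoff R (a − ·)` of the tree (`WholeSpaceIBP.cutoff`): smooth, `0 ≤ ψ ≤ 1`, `= 1` on `B̄(a,R)`,
  `= 0` off `B(a,2R)`, compact support, `|Δψ| ≤ C_Δ/R²`, `‖Dψ‖ ≤ C_∇/R` (the lattice of lemmas is stated for a section variable `ψ`
  pinned by `hψ : ψ = fun x => cutoff R (a - x)`, so the file declares no definitions);
* `integral_fderiv_apply_eq_zero_of_divFree` — `∫ Dψ(u) = −∫ ψ div u = 0` for a divergence-free `C¹` field;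
* `abs_flux_le` — **the slice flux is mean-free**: for a divergence-free `C¹` field `u` (`‖u‖ ≤ M`, `‖Du‖ ≤ M₁`) and a `C¹` scalar
  `p` (`‖Dp‖ ≤ P`), `|∫ (Δψ|u|² + Dψ(u)|u|² + 2pDψ(u))| ≤ |B̄(a,2R)|·((C_Δ/R²)·2M·M₁·2R + (C_∇/R)·M·2M·M₁·2R + 2(C_∇/R)·M·P·2R)`
  — subtract `|u(a)|²∫Δψ = 0` and `(|u(a)|² + 2p(a))∫Dψ(u) = 0`, then only oscillations over the ball enter (mean value inequality);
* `hasDerivAt_timeWeight`, `continuousOn_timeWeight`, `integral_timeWeight_le` — `∫_s^{t₀} (AR²/((−t)√(−t)) + BR³/t²) dt ≤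
  2AR²/√(−t₀) + BR³/(−t₀)`.

WHAT THIS IS NOT: not a claim about Navier–Stokes — vector calculus and one-variable calculus (bears_on LADDER-NS N0 via crux 19708,
line sparse_energy, stub S1). [folklore]
-/

noncomputable section

-- the summit and its single sub-problem share the name (CONVENTIONS §1), as in every Theorems file
set_option linter.dupNamespace false

namespace Summit.NavierStokesRegularity.NavierStokesRegularity.Theorems.PoloidalWindowDoorPoloidalWindowRigiditySparseEnergyFarFlux

open MeasureTheory Set Function Filter Topology Metric InnerProductSpace
open scoped RealInnerProductSpace InnerProductSpace Laplacian ENNReal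
open Literature.Analysis Literature.Analysis.FluidPDE
open Summit.NavierStokesRegularity.NavierStokesRegularity.Theorems.PoloidalWindowDoorPoloidalWindowRigidityClassSpaceTimeRates
open Summit.NavierStokesRegularity.NavierStokesRegularity.Theorems.PoloidalWindowDoorPoloidalWindowRigidityClassRate
open Summit.NavierStokesRegularity.NavierStokesRegularity.Theorems.PoloidalWindowDoorPoloidalWindowRigidityWindow
open Summit.NavierStokesRegularity.NavierStokesRegularity.Theorems.PoloidalWindowDoorPoloidalWindowRigidityEllipticSliceThinStrain

variable {C : ℝ} {v : ℝ → EuclideanSpace ℝ (Fin 3) → EuclideanSpace ℝ (Fin 3)}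

/-! ### The translated cut-off `ψ = cutoff R (a − ·)` -/

section Cutoff

variable {R : ℝ} {a : EuclideanSpace ℝ (Fin 3)} {ψ : EuclideanSpace ℝ (Fin 3) → ℝ}
  (hψ : ψ = fun x => cutoff R (a - x))
include hψ

/-- `ψ` is smooth. [folklore] -/
theorem cutoffT_contDiff {n : ℕ∞} : ContDiff ℝ n ψ := by
  rw [hψ]; exact (contDiff_cutoff R).comp (contDiff_const.sub contDiff_id)

/-- `0 ≤ ψ ≤ 1`. [folklore] -/
theorem cutoffT_nonneg_le_one (x : EuclideanSpace ℝ (Fin 3)) : 0 ≤ ψ x ∧ ψ x ≤ 1 := by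
  rw [hψ]; exact ⟨cutoff_nonneg _ _, cutoff_le_one _ _⟩

/-- `ψ = 1` on `B̄(a,R)`. [folklore] -/
theorem cutoffT_eq_one (hR : 0 < R) {x : EuclideanSpace ℝ (Fin 3)} (hx : dist x a ≤ R) : ψ x = 1 := by
  rw [hψ]; exact cutoff_eq_one hR (by rwa [← dist_eq_norm, dist_comm])

/-- `ψ = 0` off `B(a,2R)`. [folklore] -/
theorem cutoffT_eq_zero (hR : 0 < R) {x : EuclideanSpace ℝ (Fin 3)} (hx : 2 * R ≤ dist x a) : ψ x = 0 := by
  rw [hψ]; exact cutoff_eq_zero hR (by rwa [← dist_eq_norm, dist_comm])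

/-- `ψ` has compact support (inside `B̄(a,2R)`). [folklore] -/
theorem cutoffT_hasCompactSupport (hR : 0 < R) : HasCompactSupport ψ := by
  refine HasCompactSupport.intro (isCompact_closedBall a (2 * R)) fun x hx => ?_
  rw [mem_closedBall, not_le] at hx
  exact cutoffT_eq_zero hψ hR hx.le

/-- `Δψ = 0` and `Dψ = 0` off `B̄(a,2R)`. [folklore] -/
theorem cutoffT_derivs_eq_zero (hR : 0 < R) {x : EuclideanSpace ℝ (Fin 3)} (hx : 2 * R < dist x a) :
    (Δ ψ) x = 0 ∧ fderiv ℝ ψ x = 0 := by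
  have hn : 2 * R < ‖a - x‖ := by rwa [← dist_eq_norm, dist_comm]
  have h2 : ContDiff ℝ 2 (cutoff R : EuclideanSpace ℝ (Fin 3) → ℝ) := contDiff_cutoff R
  have h1 : ContDiff ℝ 1 (cutoff R : EuclideanSpace ℝ (Fin 3) → ℝ) := contDiff_cutoff R
  constructor
  · rw [hψ, laplacian_comp_sub_left h2 a x, laplacian_cutoff_eq_zero_of_two_mul_lt hR hn]
  · ext w
    rw [hψ, FunctionSpaces.fderiv_comp_sub_left_apply h1 a x w, fderiv_cutoff_eq_zero_of_two_mul_lt hR hn]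
    simp

/-- The cut-off bounds: `|Δψ| ≤ C_Δ/R²`, `‖Dψ‖ ≤ C_∇/R`, with the tree's universal constants. [folklore] -/
theorem cutoffT_bounds (hR : 0 < R) {Cl Cg : ℝ}
    (hCl : ∀ R : ℝ, 0 < R → ∀ x : EuclideanSpace ℝ (Fin 3), |(Δ (cutoff R : EuclideanSpace ℝ (Fin 3) → ℝ)) x| ≤ Cl / R ^ 2)
    (hCg : ∀ R : ℝ, 0 < R → ∀ x : EuclideanSpace ℝ (Fin 3), ‖fderiv ℝ (cutoff R : EuclideanSpace ℝ (Fin 3) → ℝ) x‖ ≤ Cg / R)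
    (x : EuclideanSpace ℝ (Fin 3)) : |(Δ ψ) x| ≤ Cl / R ^ 2 ∧ ‖fderiv ℝ ψ x‖ ≤ Cg / R := by
  have h2 : ContDiff ℝ 2 (cutoff R : EuclideanSpace ℝ (Fin 3) → ℝ) := contDiff_cutoff R
  have h1 : ContDiff ℝ 1 (cutoff R : EuclideanSpace ℝ (Fin 3) → ℝ) := contDiff_cutoff R
  constructor
  · rw [hψ, laplacian_comp_sub_left h2 a x]; exact hCl R hR _
  · have he : fderiv ℝ ψ x = -fderiv ℝ (cutoff R : EuclideanSpace ℝ (Fin 3) → ℝ) (a - x) := by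
      ext w; rw [hψ, FunctionSpaces.fderiv_comp_sub_left_apply h1 a x w]; simp
    rw [he, norm_neg]; exact hCg R hR _

end Cutoff

/-! ### The slice flux of the local energy identity is mean-free: oscillation bound -/

/-- `⟪u, ∇ψ⟫ = Dψ(u)`. [folklore] -/
theorem inner_gradient_eq_fderiv (ψ : EuclideanSpace ℝ (Fin 3) → ℝ) (x w : EuclideanSpace ℝ (Fin 3)) :
    ⟪w, gradient ψ x⟫ = fderiv ℝ ψ x w := by
  rw [gradient, real_inner_comm, InnerProductSpace.toDual_symm_apply]

/-- **`∫ Dψ(u) = 0` for a divergence-free `C¹` field and a compactly supported `C¹` weight** (`= −∫ ψ div u`). [folklore] -/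
theorem integral_fderiv_apply_eq_zero_of_divFree {ψ : EuclideanSpace ℝ (Fin 3) → ℝ} (hψ1 : ContDiff ℝ 1 ψ)
    (hψc : HasCompactSupport ψ) {u : EuclideanSpace ℝ (Fin 3) → EuclideanSpace ℝ (Fin 3)} (hu : ContDiff ℝ 1 u)
    (hdiv : ∀ x, VectorCalculus.divergence u x = 0) : ∫ x, fderiv ℝ ψ x (u x) = 0 := by
  have h := integral_mul_divergence_add_eq_zero_left hψ1 hu hψc
  have h0 : ∫ x, ψ x * VectorCalculus.divergence u x = 0 := by
    simp [hdiv]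
  rw [h0, zero_add] at h
  simpa [inner_gradient_eq_fderiv] using h

section Flux

variable {R : ℝ} {a : EuclideanSpace ℝ (Fin 3)} {ψ : EuclideanSpace ℝ (Fin 3) → ℝ}
  (hψ : ψ = fun x => cutoff R (a - x))
include hψ

/-- **THE SLICE FLUX IS MEAN-FREE — OSCILLATION BOUND.**  For a divergence-free `C¹` field `u` with `‖u‖ ≤ M`, `‖Du‖ ≤ M₁` and a
`C¹` scalar `p` with `‖Dp‖ ≤ P`, the flux of the local energy identity against `ψ = cutoff R (a − ·)` obeys
`|∫ (Δψ|u|² + Dψ(u)|u|² + 2pDψ(u))| ≤ |B̄(a,2R)|·((C_Δ/R²)·4MM₁R + (C_∇/R)·M·4MM₁R + 2(C_∇/R)·M·2PR)`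
(subtract `|u(a)|²∫Δψ = 0`, `(|u(a)|² + 2p(a))∫Dψ(u) = 0` and use `|u(x)|² − |u(a)|²| ≤ 2M·M₁·2R`, `|p(x) − p(a)| ≤ P·2R` on the ball).
[folklore] -/
theorem abs_flux_le (hR : 0 < R) {Cl Cg : ℝ}
    (hCl : ∀ R : ℝ, 0 < R → ∀ x : EuclideanSpace ℝ (Fin 3), |(Δ (cutoff R : EuclideanSpace ℝ (Fin 3) → ℝ)) x| ≤ Cl / R ^ 2)
    (hCg : ∀ R : ℝ, 0 < R → ∀ x : EuclideanSpace ℝ (Fin 3), ‖fderiv ℝ (cutoff R : EuclideanSpace ℝ (Fin 3) → ℝ) x‖ ≤ Cg / R)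
    {u : EuclideanSpace ℝ (Fin 3) → EuclideanSpace ℝ (Fin 3)} {p : EuclideanSpace ℝ (Fin 3) → ℝ}
    (hu : ContDiff ℝ 1 u) (hdiv : ∀ x, VectorCalculus.divergence u x = 0) (hp : ContDiff ℝ 1 p)
    {M M₁ P : ℝ} (hM : 0 ≤ M) (hM₁ : 0 ≤ M₁) (hP : 0 ≤ P)
    (huM : ∀ x, ‖u x‖ ≤ M) (hDu : ∀ x, ‖fderiv ℝ u x‖ ≤ M₁) (hDp : ∀ x, ‖fderiv ℝ p x‖ ≤ P) :
    |∫ x, ((Δ ψ) x * ‖u x‖ ^ 2 + fderiv ℝ ψ x (u x) * ‖u x‖ ^ 2 + 2 * (p x * fderiv ℝ ψ x (u x)))| ≤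
      (volume (closedBall a (2 * R))).toReal *
        (Cl / R ^ 2 * (2 * M * (M₁ * (2 * R))) + Cg / R * M * (2 * M * (M₁ * (2 * R))) + 2 * (Cg / R * M * (P * (2 * R)))) := by
  have hψ2 : ContDiff ℝ 2 ψ := cutoffT_contDiff hψ
  have hψ1 : ContDiff ℝ 1 ψ := cutoffT_contDiff hψ
  have hψc : HasCompactSupport ψ := cutoffT_hasCompactSupport hψ hR
  have hCl0 : 0 ≤ Cl / R ^ 2 := le_trans (abs_nonneg _) (hCl R hR 0)
  have hCg0 : 0 ≤ Cg / R := le_trans (norm_nonneg _) (hCg R hR 0)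
  -- continuity of the players
  have hcΔ : Continuous (Δ ψ) := continuous_laplacian hψ2
  have hcD : Continuous fun x => fderiv ℝ ψ x (u x) := (hψ1.continuous_fderiv one_ne_zero).clm_apply hu.continuous
  have hcu2 : Continuous fun x => ‖u x‖ ^ 2 := (hu.continuous.norm).pow 2
  -- everything vanishes off the closed ball
  have hout : ∀ x, x ∉ closedBall a (2 * R) → (Δ ψ) x = 0 ∧ fderiv ℝ ψ x = 0 := by
    intro x hx
    rw [mem_closedBall, not_le] at hx
    exact cutoffT_derivs_eq_zero hψ hR hx
  -- the flux integrand `f` and its "mean" part `g`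
  set f : EuclideanSpace ℝ (Fin 3) → ℝ := fun x =>
    (Δ ψ) x * ‖u x‖ ^ 2 + fderiv ℝ ψ x (u x) * ‖u x‖ ^ 2 + 2 * (p x * fderiv ℝ ψ x (u x)) with hf
  set g : EuclideanSpace ℝ (Fin 3) → ℝ := fun x =>
    ‖u a‖ ^ 2 * (Δ ψ) x + (‖u a‖ ^ 2 + 2 * p a) * fderiv ℝ ψ x (u x) with hg
  set h : EuclideanSpace ℝ (Fin 3) → ℝ := fun x =>
    (Δ ψ) x * (‖u x‖ ^ 2 - ‖u a‖ ^ 2) + fderiv ℝ ψ x (u x) * (‖u x‖ ^ 2 - ‖u a‖ ^ 2) +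
      2 * ((p x - p a) * fderiv ℝ ψ x (u x)) with hh
  have hfgh : ∀ x, h x = f x - g x := fun x => by simp only [hf, hg, hh]; ring
  have hsuppK : ∀ {F : EuclideanSpace ℝ (Fin 3) → ℝ}, (∀ x, x ∉ closedBall a (2 * R) → F x = 0) → HasCompactSupport F :=
    fun hF => HasCompactSupport.intro (isCompact_closedBall a (2 * R)) hF
  have hf0 : ∀ x, x ∉ closedBall a (2 * R) → f x = 0 := fun x hx => by
    obtain ⟨h1, h2⟩ := hout x hx; simp only [hf, h1, h2]; simp
  have hg0 : ∀ x, x ∉ closedBall a (2 * R) → g x = 0 := fun x hx => by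
    obtain ⟨h1, h2⟩ := hout x hx; simp only [hg, h1, h2]; simp
  have hh0 : ∀ x, x ∉ closedBall a (2 * R) → h x = 0 := fun x hx => by rw [hfgh, hf0 x hx, hg0 x hx, sub_zero]
  have hfc : Continuous f := by
    rw [hf]; exact ((hcΔ.mul hcu2).add (hcD.mul hcu2)).add (continuous_const.mul (hp.continuous.mul hcD))
  have hgc : Continuous g := by
    rw [hg]; exact (continuous_const.mul hcΔ).add (continuous_const.mul hcD)
  have hfi : Integrable f := hfc.integrable_of_hasCompactSupport (hsuppK hf0)
  have hgi : Integrable g := hgc.integrable_of_hasCompactSupport (hsuppK hg0)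
  -- the mean part integrates to zero
  have hg_int : ∫ x, g x = 0 := by
    have i1 : Integrable fun x => ‖u a‖ ^ 2 * (Δ ψ) x := (hcΔ.integrable_of_hasCompactSupport (hsuppK fun x hx => (hout x hx).1)).const_mul _
    have i2 : Integrable fun x => (‖u a‖ ^ 2 + 2 * p a) * fderiv ℝ ψ x (u x) :=
      (hcD.integrable_of_hasCompactSupport (hsuppK fun x hx => by rw [(hout x hx).2]; simp)).const_mul _
    rw [hg, integral_add i1 i2, integral_const_mul, integral_const_mul,
      integral_laplacian_eq_zero_of_hasCompactSupport hψ2 hψc, integral_fderiv_apply_eq_zero_of_divFree hψ1 hψc hu hdiv]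
    ring
  have hfh : ∫ x, f x = ∫ x, h x := by
    have : ∫ x, h x = ∫ x, (f x - g x) := integral_congr_ae (Eventually.of_forall hfgh)
    rw [this, integral_sub hfi hgi, hg_int, sub_zero]
  -- pointwise oscillation bounds on the ball
  have hosc_u : ∀ x ∈ closedBall a (2 * R), |‖u x‖ ^ 2 - ‖u a‖ ^ 2| ≤ 2 * M * (M₁ * (2 * R)) := by
    intro x hx
    rw [mem_closedBall, dist_eq_norm] at hx
    have hmv : ‖u x - u a‖ ≤ M₁ * ‖x - a‖ :=
      (convex_univ).norm_image_sub_le_of_norm_fderiv_le (fun y _ => hu.differentiable one_ne_zero y) (fun y _ => hDu y)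
        (mem_univ a) (mem_univ x)
    have h1 : |‖u x‖ - ‖u a‖| ≤ M₁ * (2 * R) :=
      (abs_norm_sub_norm_le _ _).trans (hmv.trans (mul_le_mul_of_nonneg_left hx hM₁))
    have h2 : |‖u x‖ + ‖u a‖| ≤ 2 * M := by
      rw [abs_of_nonneg (by positivity)]; linarith [huM x, huM a]
    calc |‖u x‖ ^ 2 - ‖u a‖ ^ 2| = |‖u x‖ + ‖u a‖| * |‖u x‖ - ‖u a‖| := by rw [← abs_mul]; ring_nf
      _ ≤ 2 * M * (M₁ * (2 * R)) := mul_le_mul h2 h1 (abs_nonneg _) (by positivity)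
  have hosc_p : ∀ x ∈ closedBall a (2 * R), |p x - p a| ≤ P * (2 * R) := by
    intro x hx
    rw [mem_closedBall, dist_eq_norm] at hx
    have hmv : ‖p x - p a‖ ≤ P * ‖x - a‖ :=
      (convex_univ).norm_image_sub_le_of_norm_fderiv_le (fun y _ => hp.differentiable one_ne_zero y) (fun y _ => hDp y)
        (mem_univ a) (mem_univ x)
    rw [Real.norm_eq_abs] at hmv
    exact hmv.trans (mul_le_mul_of_nonneg_left hx hP)
  have hDψu : ∀ x, |fderiv ℝ ψ x (u x)| ≤ Cg / R * M := fun x => by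
    rw [← Real.norm_eq_abs]
    calc ‖fderiv ℝ ψ x (u x)‖ ≤ ‖fderiv ℝ ψ x‖ * ‖u x‖ := ContinuousLinearMap.le_opNorm _ _
      _ ≤ Cg / R * M := mul_le_mul (cutoffT_bounds hψ hR hCl hCg x).2 (huM x) (norm_nonneg _) hCg0
  have hbound : ∀ x ∈ closedBall a (2 * R), ‖h x‖ ≤
      Cl / R ^ 2 * (2 * M * (M₁ * (2 * R))) + Cg / R * M * (2 * M * (M₁ * (2 * R))) + 2 * (Cg / R * M * (P * (2 * R))) := by
    intro x hx
    rw [Real.norm_eq_abs, hh]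
    refine (abs_add_le _ _).trans (add_le_add ((abs_add_le _ _).trans (add_le_add ?_ ?_)) ?_)
    · rw [abs_mul]
      exact mul_le_mul (cutoffT_bounds hψ hR hCl hCg x).1 (hosc_u x hx) (abs_nonneg _) hCl0
    · rw [abs_mul]
      exact mul_le_mul (hDψu x) (hosc_u x hx) (abs_nonneg _) (by positivity)
    · rw [abs_mul, abs_two, abs_mul, mul_comm |p x - p a|]
      exact mul_le_mul_of_nonneg_left (mul_le_mul (hDψu x) (hosc_p x hx) (abs_nonneg _) (by positivity)) zero_le_two
  -- integrate over the closed ball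
  have hvol : volume (closedBall a (2 * R)) < ∞ := measure_closedBall_lt_top
  change |∫ x, f x| ≤ _
  rw [hfh, ← setIntegral_eq_integral_of_forall_compl_eq_zero (s := closedBall a (2 * R)) fun x hx => hh0 x hx,
    ← Real.norm_eq_abs]
  have key := norm_setIntegral_le_of_norm_le_const hvol hbound
  rw [measureReal_def] at key
  linarith [key]

end Flux

/-! ### Calculus of the time weights `R²/((−t)√(−t))` and `R³/t²` -/

/-- The antiderivative of `A R²/((−t)√(−t)) + B R³/t²` on `t < 0` is `2AR²/√(−t) + BR³/(−t)`. [folklore] -/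
theorem hasDerivAt_timeWeight (A B R : ℝ) {t : ℝ} (ht : t < 0) :
    HasDerivAt (fun τ => 2 * A * R ^ 2 * (Real.sqrt (-τ))⁻¹ + B * R ^ 3 * (-τ)⁻¹)
      (A * R ^ 2 / ((-t) * Real.sqrt (-t)) + B * R ^ 3 / t ^ 2) t := by
  have hnt : 0 < -t := neg_pos.2 ht
  have hsq : 0 < Real.sqrt (-t) := Real.sqrt_pos.2 hnt
  have h1 : HasDerivAt (fun τ => Real.sqrt (-τ)) (1 / (2 * Real.sqrt (-t)) * (-1)) t :=
    (Real.hasDerivAt_sqrt hnt.ne').comp t (hasDerivAt_neg t)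
  have h2 : HasDerivAt (fun τ => (Real.sqrt (-τ))⁻¹) (-(1 / (2 * Real.sqrt (-t)) * (-1)) / Real.sqrt (-t) ^ 2) t :=
    h1.inv hsq.ne'
  have h3 : HasDerivAt (fun τ : ℝ => (-τ)⁻¹) (-(-1 : ℝ) / (-t) ^ 2) t := (hasDerivAt_neg t).inv hnt.ne'
  have h := (h2.const_mul (2 * A * R ^ 2)).add (h3.const_mul (B * R ^ 3))
  refine h.congr_deriv ?_
  have hs2 : Real.sqrt (-t) ^ 2 = -t := Real.sq_sqrt hnt.le
  rw [hs2]
  field_simp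

/-- The time weight is continuous on `[s, t₀]` for `t₀ < 0`. [folklore] -/
theorem continuousOn_timeWeight (A B R : ℝ) {s t₀ : ℝ} (hst : s ≤ t₀) (ht₀ : t₀ < 0) :
    ContinuousOn (fun t : ℝ => A * R ^ 2 / ((-t) * Real.sqrt (-t)) + B * R ^ 3 / t ^ 2) (uIcc s t₀) := by
  rw [uIcc_of_le hst]
  refine ContinuousOn.add ?_ ?_
  · refine continuousOn_const.div ((continuousOn_id.neg).mul (continuousOn_id.neg.sqrt)) fun t ht => ?_
    have hnt : 0 < -t := neg_pos.2 (lt_of_le_of_lt ht.2 ht₀)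
    exact (mul_pos hnt (Real.sqrt_pos.2 hnt)).ne'
  · refine continuousOn_const.div (continuousOn_id.pow 2) fun t ht => ?_
    exact pow_ne_zero 2 (lt_of_le_of_lt ht.2 ht₀).ne

/-- `∫_{s}^{t₀} (A R²/((−t)√(−t)) + B R³/t²) dt ≤ 2AR²/√(−t₀) + BR³/(−t₀)` for `s ≤ t₀ < 0`, `A, B, R ≥ 0`. [folklore] -/
theorem integral_timeWeight_le {A B R : ℝ} (hA : 0 ≤ A) (hB : 0 ≤ B) (hR : 0 ≤ R) {s t₀ : ℝ} (hst : s ≤ t₀) (ht₀ : t₀ < 0) :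
    ∫ t in s..t₀, (A * R ^ 2 / ((-t) * Real.sqrt (-t)) + B * R ^ 3 / t ^ 2) ≤
      2 * A * R ^ 2 / Real.sqrt (-t₀) + B * R ^ 3 / (-t₀) := by
  have hderiv : ∀ t ∈ uIcc s t₀, HasDerivAt (fun τ => 2 * A * R ^ 2 * (Real.sqrt (-τ))⁻¹ + B * R ^ 3 * (-τ)⁻¹)
      (A * R ^ 2 / ((-t) * Real.sqrt (-t)) + B * R ^ 3 / t ^ 2) t := by
    intro t ht
    rw [uIcc_of_le hst] at ht
    exact hasDerivAt_timeWeight A B R (lt_of_le_of_lt ht.2 ht₀)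
  rw [intervalIntegral.integral_eq_sub_of_hasDerivAt hderiv ((continuousOn_timeWeight A B R hst ht₀).intervalIntegrable)]
  have hns : 0 < -s := by linarith
  have h1 : 0 ≤ 2 * A * R ^ 2 * (Real.sqrt (-s))⁻¹ := by positivity
  have h2 : 0 ≤ B * R ^ 3 * (-s)⁻¹ := by positivity
  have e : 2 * A * R ^ 2 * (Real.sqrt (-t₀))⁻¹ + B * R ^ 3 * (-t₀)⁻¹ = 2 * A * R ^ 2 / Real.sqrt (-t₀) + B * R ^ 3 / (-t₀) := by
    rw [div_eq_mul_inv, div_eq_mul_inv]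
  linarith

end Summit.NavierStokesRegularity.NavierStokesRegularity.Theorems.PoloidalWindowDoorPoloidalWindowRigiditySparseEnergyFarFlux

end
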